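import Literature.Algebra.EuclideanLattices.GaussianNoiseOneDim
import Literature.Probability.Distributions.GaussianLinearCompensation
import HarnessLib

/-!
# The spherical continuous Gaussian `D_s` on `ℝⁿ` as a multivariate Gaussian, and "`Ue + f ∼ D_{αξ}`" (BLPRS 2013, Lemma 4.7)

Topic `Algebra/EuclideanLattices` (family `pqc`), bridging the tree's `continuousGaussian E s = D_s`
(density `ρ_s/sⁿ`, `GaussianCosetSmoothing.lean`; `continuousGaussian_eq_map_smul_stdGaussian`,
`GaussianNoiseOneDim.lean`) with Mathlib's `multivariateGaussian μ S` on `EuclideanSpace ℝ ι` and the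
Gaussian algebra of `Probability/Distributions/GaussianLinearCompensation.lean`. Proved glue (no named
fact) towards `Literature.Computability.Cryptography.blprs_gapSVP_sqrt_dim_to_lwe_classical` (pqc.S21),
BLPRS Lemma 4.7:

> *"Since `Ue` is distributed as a continuous Gaussian `D_{αU'}`, the vector `Ue + f` is distributed as a
> spherical continuous Gaussian `D_{αξ}`."* (arXiv:1306.0281, proof of Lemma 4.7; `e` has its first
> coordinate `0` and the others from `D_α`, `f ∼ D_{α(ξ²I - U'U'ᵀ)^{1/2}}`.)

## Results (`ι, κ` finite; `D_s = continuousGaussian (EuclideanSpace ℝ ·) s`, `N(S) = multivariateGaussian 0 S`)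

* `matrixCLM_smul_one_apply` — the map of `a • 1` is `x ↦ a • x`;
* `multivariateGaussian_smul_one_eq_map_smul` — `N(c I) = stdGaussian ∘ (√c • ·)⁻¹` for `c ≥ 0`;
* **`continuousGaussian_euclidean_eq_multivariateGaussian`** — `D_s = N((s²/(2π)) I)` on `ℝ^ι` for `0 < s`
  (so the noisy coordinates `e' ∼ D_α^{κ}` of the first-is-errorless samples form `D_α` on `ℝ^κ`);
* **`continuousGaussian_map_conv_compensation`** — for `0 < α`, `0 < ξ` and a real matrix `U'` with
  `‖U'y‖² ≤ ξ²‖y‖²` for all `y` (the quality bound, Def. 4.5): `(D_α ∘ U'⁻¹) ∗ N((α²/(2π))(ξ²I - U'U'ᵀ)) = D_{αξ}`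
  — "`Ue + f` is distributed as the spherical `D_{αξ}`".

## References

* Z. Brakerski, A. Langlois, C. Peikert, O. Regev, D. Stehlé, *Classical hardness of learning with errors*,
  STOC 2013; arXiv:1306.0281, proof of Lemma 4.7; §2.2 (`D_s`).
-/

noncomputable section

open MeasureTheory ProbabilityTheory Module Matrix Literature.Probability.Distributions
open scoped Real ENNReal NNReal Matrix

namespace Literature.Algebra.EuclideanLattices

variable {ι κ : Type} [Fintype ι] [DecidableEq ι] [Fintype κ] [DecidableEq κ]

/-- The map of the scalar matrix `a • 1` is scalar multiplication by `a`. [folklore] -/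
theorem matrixCLM_smul_one_apply (a : ℝ) (x : EuclideanSpace ℝ ι) :
    matrixCLM (a • (1 : Matrix ι ι ℝ)) x = a • x := by
  apply WithLp.ofLp_injective 2
  rw [ofLp_matrixCLM, WithLp.ofLp_smul, smul_mulVec, one_mulVec]

/-- **`N(0, cI)` is the standard Gaussian scaled by `√c`** (`c ≥ 0`): the image of `N(0, I) = stdGaussian`
under the map of `√c • 1`, whose covariance is `(√c•1) I (√c•1)ᵀ = c I`. [folklore] -/
theorem multivariateGaussian_smul_one_eq_map_smul {c : ℝ} (hc : 0 ≤ c) :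
    multivariateGaussian (0 : EuclideanSpace ℝ ι) (c • (1 : Matrix ι ι ℝ)) =
      (stdGaussian (EuclideanSpace ℝ ι)).map fun x => Real.sqrt c • x := by
  have hmat : (Real.sqrt c • (1 : Matrix ι ι ℝ)) * 1 * (Real.sqrt c • (1 : Matrix ι ι ℝ))ᵀ =
      c • (1 : Matrix ι ι ℝ) := by
    rw [Matrix.mul_one, transpose_smul, transpose_one, Matrix.smul_mul, Matrix.one_mul, smul_smul,
      Real.mul_self_sqrt hc]
  rw [← hmat, ← multivariateGaussian_map_matrix PosSemidef.one, multivariateGaussian_zero_one]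
  congr 1
  funext x
  exact matrixCLM_smul_one_apply _ _

/-- **The spherical continuous Gaussian is a multivariate Gaussian**: for `0 < s`, on `ℝ^ι`,
`D_s = N(0, (s²/(2π)) I)` (`D_s` is the law of `(s/√(2π)) · X`, `X` standard; `(s/√(2π))² = s²/(2π)`).
[cite: BrakerskiEtAl2013, §2.2] -/
theorem continuousGaussian_euclidean_eq_multivariateGaussian {s : ℝ} (hs : 0 < s) :
    continuousGaussian (EuclideanSpace ℝ ι) s =
      multivariateGaussian (0 : EuclideanSpace ℝ ι) ((s ^ 2 / (2 * π)) • (1 : Matrix ι ι ℝ)) := by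
  have h2π : 0 < 2 * π := by positivity
  rw [continuousGaussian_eq_map_smul_stdGaussian hs,
    multivariateGaussian_smul_one_eq_map_smul (by positivity : 0 ≤ s ^ 2 / (2 * π)),
    Real.sqrt_div (sq_nonneg s), Real.sqrt_sq hs.le]

/-- **"`Ue + f` is distributed as the spherical `D_{αξ}`"** (BLPRS Lemma 4.7): for `0 < α`, `0 < ξ` and a
real matrix `U'` with `‖U'y‖² ≤ ξ²‖y‖²` for every `y`, the law of `U'e' + f` with `e' ∼ D_α` on `ℝ^κ`
(the noisy coordinates) and an independent compensation `f ∼ N(0, (α²/(2π))(ξ²I - U'U'ᵀ))` is `D_{αξ}` on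
`ℝ^ι`. [cite: BrakerskiEtAl2013, Lemma 4.7 (proof)] -/
theorem continuousGaussian_map_conv_compensation (U : Matrix ι κ ℝ) {α ξ : ℝ} (hα : 0 < α) (hξ : 0 < ξ)
    (hU : ∀ y : κ → ℝ, (U *ᵥ y) ⬝ᵥ (U *ᵥ y) ≤ ξ ^ 2 * (y ⬝ᵥ y)) :
    (continuousGaussian (EuclideanSpace ℝ κ) α).map (matrixCLM U) ∗
        multivariateGaussian (0 : EuclideanSpace ℝ ι)
          ((α ^ 2 / (2 * π)) • (ξ ^ 2 • (1 : Matrix ι ι ℝ) - U * Uᵀ)) =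
      continuousGaussian (EuclideanSpace ℝ ι) (α * ξ) := by
  have h2π : 0 < 2 * π := by positivity
  rw [continuousGaussian_euclidean_eq_multivariateGaussian hα,
    continuousGaussian_euclidean_eq_multivariateGaussian (mul_pos hα hξ),
    map_matrix_multivariateGaussian_conv_compensation U (by positivity) hU]
  congr 2
  ring

end Literature.Algebra.EuclideanLattices

end
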